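import Literature.Barriers.AtomisticToContinuum.KineticGapLengthScalesScaling
import Literature.MathematicalPhysics.QuantumManyBody.EnergyLocalization
import Literature.MathematicalPhysics.QuantumManyBody.GeneralizedPoincare
import Literature.MathematicalPhysics.QuantumManyBody.PeriodicBoseGasFourier
import Literature.MathematicalPhysics.QuantumManyBody.PeriodicBoseGasUpperBoundProofs
import Mathlib.MeasureTheory.Function.L2Space
import Mathlib.MeasureTheory.Integral.Average
import Mathlib.MeasureTheory.Measure.Lebesgue.VolumeOfBalls
import HarnessLib

/-!
# LSSY Theorem 5.1 from Lemma 4.1 and Lemma 5.2: the assembly (5.15)–(5.17)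

`Literature/Barriers/AtomisticToContinuum`, companion of `KineticGapLengthScales.lean` (provefact
`Literature.Barriers.AtomisticToContinuum.KineticGapLengthScales` =
`Literature.Barriers.AtomisticToContinuum.BoseGas.LSSY2005_thm51_periodic`, LSSY Thm. 5.1:
complete BEC in the Gross–Pitaevskii limit, periodic box).

The printed proof of Thm. 5.1 [LSSY2005, p. 25] "has two main ingredients": the localization of
the energy, Lemma 5.2 (vendored as the named fact `LSSY2005_lemma52_periodic` of
`EnergyLocalization.lean`), and the generalized Poincaré inequality, Lemma 4.1 (named fact
`LSSY2005_lemma41_periodic` of `GeneralizedPoincare.lean`); it combines them with the upper bound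
(2.14) of Thm. 2.2 (proved in the tree: `LSSY2005_upperBound_periodic_holds`). This file proves
the combination, i.e. Theorem 5.1 *relative to the two lemmas*:

* `lintegral_nnnorm_sq_cell_eq` — `∫_K |f|² = ∫_K |f - ⟨f⟩_K|² + L⁻³|∫_K f|²` on the cell
  `K = [0,L)³` (the identity behind (5.17));
* `depletion`, `condensateOccupation_add_depletion` — (5.17) symmetrised over the particles:
  `⟨Ψ, n₀Ψ⟩ + ∑ᵢ L⁻³ ∫_{K^N} dX ∫_K dx |Ψ(…,xᵢ = x,…) - ⟨Ψ(…,xᵢ = ·,…)⟩_K|² = N`, in particular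
  `⟨Ψ, n₀Ψ⟩ ≤ N`;
* `farSet`, `volume_cell_diff_farSet_le` — `Ω_X = {x₁ : min_{j ≥ 2}|x₁ - xⱼ| ≥ R}` and
  `|Ω_X^c| ≤ (4π/3) N R³` [LSSY2005, after (5.15)];
* `depletion_le_of_lemma41` — Lemma 4.1 applied to every slice and integrated:
  `N - ⟨Ψ,n₀Ψ⟩ ≤ C (L² T^out + |Ω^c|^{2/3} T)`, `T^out = ∫ kineticOutside R Ψ`, `T = ∫ |∇Ψ|²`
  (this is (5.15) before the energy bounds are inserted);
* `condensate_lower_bound` — with Lemma 5.2 (`T^out ≤ (⟨Ψ,HΨ⟩/(1-cY^{1/17}) - 4πρaN)`) and an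
  energy bound `⟨Ψ, HΨ⟩ ≤ U` for the near-minimiser: `N ≤ ⟨Ψ,n₀Ψ⟩ + η` with `η` explicit;
* `LSSY2005_thm51_periodic_of_lemmas` — in the fixed-potential picture of the GP limit
  (`periodicCondensateNumber_gp_eq`: `a = 1`, `L = N/g`, `ρ = g³/N²`, `Y = 4πg³/(3N²) → 0`,
  `ρaL² = g`), `η/N → 0` by Thm. 2.2, "the terms `4πμρaL²` on both sides of the resulting
  inequality cancel … in the limit considered `ρaL² = const.` while `Y → 0`" (5.16); hence
  `LSSY2005_lemma41_periodic → LSSY2005_lemma52_periodic → LSSY2005_thm51_periodic`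
  (the named facts of `GeneralizedPoincare.lean`, rev. 2 with the `Ω`-integral parenthesised,
  and of `EnergyLocalization.lean`), and the same for the catalogue entry
  `KineticGapLengthScales` (`kineticGapLengthScales_of_lemmas`). The intermediate theorems take
  Lemma 4.1 with its constant exposed (`∀ L f Ω, … ≤ ofReal C * (…)`).

What is NOT here: proofs of the two lemmas (Lemma 4.1, periodic case, is proved in
`GeneralizedPoincareProofs.lean`; Lemma 5.2 is a re-run of the proof of Thm. 2.4 keeping the
unused kinetic energy `T^out`, tracked in the provefact notes).

## References

* [LSSY2005] E. H. Lieb, R. Seiringer, J. P. Solovej, J. Yngvason, *The Mathematics of the Bose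
  Gas and its Condensation*, Oberwolfach Seminars 34, Birkhäuser 2005 (arXiv:cond-mat/0610117):
  Thm. 5.1 (5.4), Lemma 5.2 (5.7)–(5.8), proof of Thm. 5.1 (5.15)–(5.17), p. 25 of the arXiv
  edition; Thm. 2.2 (2.14); Lemma 4.1 (4.2).
-/

noncomputable section

open MeasureTheory Filter Topology Metric
open scoped ENNReal NNReal

namespace Literature.Barriers.AtomisticToContinuum.BoseGas

open Literature.MathematicalPhysics.QuantumManyBody.BoseGas

/-! ### The variance identity on the cell -/

/-- `(ofReal L)³ = ofReal (L³)` and its inverse is `ofReal (L³)⁻¹`, for `L > 0`. [folklore] -/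
theorem inv_ofReal_pow_three {L : ℝ} (hL : 0 < L) :
    (ENNReal.ofReal L ^ 3)⁻¹ = ENNReal.ofReal ((L ^ 3)⁻¹) := by
  rw [← ENNReal.ofReal_pow hL.le, ENNReal.ofReal_inv_of_pos (by positivity)]

/-- **The variance identity** `∫_K |f|² = ∫_K |f - ⟨f⟩_K|² + L⁻³ |∫_K f|²` on the cell
`K = [0,L)³`, `⟨f⟩_K = L⁻³∫_K f`, for continuous `f` (Pythagoras for the projection onto the
constants in `L²(K)`; the identity behind (5.17)). [cite: LSSY2005, Ch. 5 (5.17)] -/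
theorem lintegral_nnnorm_sq_cell_eq {L : ℝ} (hL : 0 < L) {φ : Space → ℂ} (hφ : Continuous φ) :
    ∫⁻ x in cell L, (‖φ x‖₊ : ℝ≥0∞) ^ 2 =
      (∫⁻ x in cell L, (‖φ x - ⨍ y in cell L, φ y‖₊ : ℝ≥0∞) ^ 2) +
        (ENNReal.ofReal L ^ 3)⁻¹ * (‖∫ x in cell L, φ x‖₊ : ℝ≥0∞) ^ 2 := by
  set c : ℂ := ⨍ y in cell L, φ y with hc
  set I : ℂ := ∫ x in cell L, φ x with hI
  have hL3 : 0 < L ^ 3 := by positivity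
  have hV : volume.real (cell L) = L ^ 3 := by
    rw [measureReal_def, volume_cell, ← ENNReal.ofReal_pow hL.le, ENNReal.toReal_ofReal hL3.le]
  have hcI : c = (L ^ 3)⁻¹ • I := by rw [hc, setAverage_eq, hV]
  have hint : IntegrableOn φ (cell L) := integrableOn_cell hφ
  have hint2 : IntegrableOn (fun x => ‖φ x‖ ^ 2) (cell L) := integrableOn_sq_cell L hφ
  have hint3 : IntegrableOn (fun x => ‖φ x - c‖ ^ 2) (cell L) :=
    integrableOn_sq_cell L (hφ.sub continuous_const)
  have hinner : IntegrableOn (fun x => inner ℝ c (φ x)) (cell L) := hint.const_inner c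
  haveI : IsFiniteMeasure (volume.restrict (cell L)) :=
    isFiniteMeasure_restrict.2 (by rw [volume_cell]; exact ENNReal.pow_ne_top ENNReal.ofReal_ne_top)
  -- the real identity
  have key : ∫ x in cell L, ‖φ x - c‖ ^ 2 = (∫ x in cell L, ‖φ x‖ ^ 2) - (L ^ 3)⁻¹ * ‖I‖ ^ 2 := by
    have h1 : (fun x => ‖φ x - c‖ ^ 2) = fun x => (‖φ x‖ ^ 2 - 2 * inner ℝ c (φ x)) + ‖c‖ ^ 2 := by
      funext x
      rw [norm_sub_sq_real, real_inner_comm]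
    have hA : Integrable (fun x => ‖φ x‖ ^ 2 - 2 * inner ℝ c (φ x)) (volume.restrict (cell L)) :=
      hint2.sub' (hinner.const_mul 2)
    rw [h1, integral_add hA (integrable_const _),
      integral_sub hint2 (hinner.const_mul 2), integral_const_mul, setIntegral_const, hV,
      integral_inner hint c]
    change (∫ x in cell L, ‖φ x‖ ^ 2) - 2 * inner ℝ c I + (L ^ 3) • ‖c‖ ^ 2 =
      (∫ x in cell L, ‖φ x‖ ^ 2) - (L ^ 3)⁻¹ * ‖I‖ ^ 2
    rw [hcI, real_inner_smul_left, real_inner_self_eq_norm_sq, norm_smul, Real.norm_eq_abs,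
      abs_of_pos (inv_pos.2 hL3), smul_eq_mul]
    field_simp
    ring
  -- conversion to `ℝ≥0∞`
  have hnn1 : 0 ≤ ∫ x in cell L, ‖φ x - c‖ ^ 2 := integral_nonneg fun _ => by positivity
  have hnn2 : 0 ≤ (L ^ 3)⁻¹ * ‖I‖ ^ 2 := by positivity
  simp only [coe_nnnorm_sq_eq_ofReal]
  rw [← ofReal_integral_eq_lintegral_ofReal hint2 (ae_of_all _ fun _ => by positivity),
    ← ofReal_integral_eq_lintegral_ofReal hint3 (ae_of_all _ fun _ => by positivity),
    inv_ofReal_pow_three hL, ← ENNReal.ofReal_mul (inv_pos.2 hL3).le,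
    ← ENNReal.ofReal_add hnn1 hnn2, key, sub_add_cancel]

/-! ### The depletion and the identity (5.17) -/

/-- The **depletion functional** of an `N`-body function on the cell of side `L`, symmetrised
over the particles: `∑ᵢ L⁻³ ∫_{K^N} dX ∫_K dx |Ψ(…, xᵢ = x, …) - L⁻³∫_K Ψ(…, xᵢ = y, …) dy|²`.
For a Bose-symmetric normalised `Ψ` every summand equals
`∫_{K^{N-1}} dX ∫_K dx₁ |Ψ(x₁,X) - L⁻³∫_K Ψ(x,X) dx|² = 1 - N⁻¹L⁻³∬γ`, so the sum is
`N - ⟨Ψ, n₀Ψ⟩` (`condensateOccupation_add_depletion`). [cite: LSSY2005, Ch. 5 (5.17)] -/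
def depletion (N : ℕ) (L : ℝ) (Ψ : Config N → ℂ) : ℝ≥0∞ :=
  ∑ i : Fin N, (ENNReal.ofReal L ^ 3)⁻¹ *
    ∫⁻ X in cellN N L, ∫⁻ x in cell L,
      (‖Ψ (Function.update X i x) - ⨍ y in cell L, Ψ (Function.update X i y)‖₊ : ℝ≥0∞) ^ 2

/-- **(5.17), symmetrised:** `⟨Ψ, n₀Ψ⟩ + depletion = N` for a normalised Bose-symmetric periodic
state — `∫_{K^{N-1}}dX ∫_K dx₁|Ψ₀(x₁,X) - L⁻³∫_KΨ₀(x,X)dx|² = 1 - (NL³)⁻¹∬γ(x,x')dxdx'`.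
[cite: LSSY2005, Ch. 5 (5.17)] -/
theorem condensateOccupation_add_depletion {n : ℕ} {L : ℝ} (hL : 0 < L)
    (Ψ : PeriodicTrialState (n + 1) L) :
    condensateOccupation (n + 1) L Ψ.ψ + depletion (n + 1) L Ψ.ψ = ((n + 1 : ℕ) : ℝ≥0∞) := by
  have hL3 : ENNReal.ofReal L ^ 3 ≠ 0 := pow_ne_zero _ (by simpa using hL)
  have hL3' : ENNReal.ofReal L ^ 3 ≠ ⊤ := ENNReal.pow_ne_top ENNReal.ofReal_ne_top
  have hcont : Continuous Ψ.ψ := Ψ.contDiff.continuous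
  -- each slice term is `1`
  have hone : ∀ i : Fin (n + 1), (ENNReal.ofReal L ^ 3)⁻¹ *
      ∫⁻ X in cellN (n + 1) L, ∫⁻ x in cell L, (‖Ψ.ψ (Function.update X i x)‖₊ : ℝ≥0∞) ^ 2 = 1 := by
    intro i
    rw [lintegral_normSq_slice i hcont.measurable, Ψ.norm_eq, mul_one,
      ENNReal.inv_mul_cancel hL3 hL3']
  have hN : ((n + 1 : ℕ) : ℝ≥0∞) = ∑ i : Fin (n + 1), (ENNReal.ofReal L ^ 3)⁻¹ *
      ∫⁻ X in cellN (n + 1) L, ∫⁻ x in cell L, (‖Ψ.ψ (Function.update X i x)‖₊ : ℝ≥0∞) ^ 2 := by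
    simp only [hone, Finset.sum_const, Finset.card_univ, Fintype.card_fin, nsmul_eq_mul, mul_one]
  -- split each slice by the variance identity
  have hsplit : ∀ (i : Fin (n + 1)) (X : Config (n + 1)),
      ∫⁻ x in cell L, (‖Ψ.ψ (Function.update X i x)‖₊ : ℝ≥0∞) ^ 2 =
        (∫⁻ x in cell L, (‖Ψ.ψ (Function.update X i x) -
            ⨍ y in cell L, Ψ.ψ (Function.update X i y)‖₊ : ℝ≥0∞) ^ 2) +
          (ENNReal.ofReal L ^ 3)⁻¹ *
            (‖∫ x in cell L, Ψ.ψ (Function.update X i x)‖₊ : ℝ≥0∞) ^ 2 := fun i X =>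
    lintegral_nnnorm_sq_cell_eq hL (hcont.comp (continuous_const.update i continuous_id))
  have hmeas : ∀ i : Fin (n + 1), Measurable fun X : Config (n + 1) =>
      (ENNReal.ofReal L ^ 3)⁻¹ *
        (‖∫ x in cell L, Ψ.ψ (Function.update X i x)‖₊ : ℝ≥0∞) ^ 2 := fun i =>
    (measurable_sliceMeanSq L i hcont).const_mul _
  rw [hN, ← sum_lintegral_sliceMeanSq hL Ψ, depletion, ← Finset.sum_add_distrib]
  refine Finset.sum_congr rfl fun i _ => ?_
  rw [← mul_add, ← lintegral_add_left' (hmeas i).aemeasurable]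
  congr 1
  refine lintegral_congr fun X => ?_
  rw [hsplit i X, add_comm]

/-- In particular `⟨Ψ, n₀Ψ⟩ ≤ N`. [cite: LSSY2005, Ch. 5 (5.17)] -/
theorem condensateOccupation_le {n : ℕ} {L : ℝ} (hL : 0 < L)
    (Ψ : PeriodicTrialState (n + 1) L) :
    condensateOccupation (n + 1) L Ψ.ψ ≤ ((n + 1 : ℕ) : ℝ≥0∞) :=
  (condensateOccupation_add_depletion hL Ψ) ▸ le_self_add

/-! ### The encounter-free region `Ω_X` and the volume of its complement -/

/-- `Ω_{X,i} = {x : min_{j ≠ i} |x - xⱼ| ≥ R}`: the positions of particle `i` at distance at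
least `R` from all the other particles of `X` (LSSY's `Ω_X` of (5.8) for `i = 1`), written
through `nnDist` of the configuration with particle `i` moved to `x`. [cite: LSSY2005, Lemma 5.2 (5.8)] -/
def farSet {N : ℕ} (R : ℝ) (X : Config N) (i : Fin N) : Set Space :=
  {x | R ≤ nnDist (Function.update X i x) i}

/-- `Ω_{X,i}` is measurable (closed). [cite: LSSY2005, Lemma 5.2 (5.8)] -/
theorem measurableSet_farSet {N : ℕ} (R : ℝ) (X : Config N) (i : Fin N) :
    MeasurableSet (farSet R X i) :=
  measurableSet_le measurable_const
    ((continuous_nnDist i).comp (continuous_const.update i continuous_id)).measurable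

/-- The complement of `Ω_{X,i}` is covered by the balls of radius `R` about the other particles:
`Ω^c_X = {x₁ : |x₁ - xⱼ| < R for some j ≥ 2}`. [cite: LSSY2005, Lemma 5.2 (after (5.13))] -/
theorem compl_farSet_subset {N : ℕ} (hN : 1 < N) (R : ℝ) (X : Config N) (i : Fin N) :
    (farSet R X i)ᶜ ⊆ ⋃ j ∈ Finset.univ.erase i, ball (X j) R := by
  intro x hx
  have hne : (Finset.univ.erase i).Nonempty := by
    haveI : Nontrivial (Fin N) := Fin.nontrivial_iff_two_le.2 hN
    obtain ⟨j, hj⟩ := exists_ne i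
    exact ⟨j, Finset.mem_erase.2 ⟨hj, Finset.mem_univ _⟩⟩
  simp only [farSet, Set.mem_compl_iff, Set.mem_setOf_eq, not_le, nnDist, dif_pos hne,
    Finset.inf'_lt_iff] at hx
  obtain ⟨j, hj, hlt⟩ := hx
  rw [Function.update_self, Function.update_of_ne (Finset.ne_of_mem_erase hj)] at hlt
  exact Set.mem_biUnion hj (mem_ball.2 hlt)

/-- The volume bound `|Ω^c| ≤ (4π/3) N R³` as a constant. [cite: LSSY2005, Ch. 5, after (5.15)] -/
def encounterVolume (N : ℕ) (R : ℝ) : ℝ≥0∞ :=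
  (N : ℝ≥0∞) * (ENNReal.ofReal R ^ 3 * ENNReal.ofReal (Real.pi * 4 / 3))

/-- `|K ∖ Ω_{X,i}| ≤ (4π/3) N R³`. [cite: LSSY2005, Ch. 5, after (5.15)] -/
theorem volume_cell_diff_farSet_le {N : ℕ} (hN : 1 < N) (L R : ℝ) (X : Config N) (i : Fin N) :
    volume (cell L \ farSet R X i) ≤ encounterVolume N R := by
  calc volume (cell L \ farSet R X i) ≤ volume ((farSet R X i)ᶜ) :=
        measure_mono fun x hx => hx.2
    _ ≤ volume (⋃ j ∈ Finset.univ.erase i, ball (X j) R) :=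
        measure_mono (compl_farSet_subset hN R X i)
    _ ≤ ∑ j ∈ Finset.univ.erase i, volume (ball (X j) R) := measure_biUnion_finset_le _ _
    _ ≤ ∑ j : Fin N, volume (ball (X j) R) :=
        Finset.sum_le_sum_of_subset_of_nonneg (Finset.erase_subset _ _) fun _ _ _ => bot_le
    _ = encounterVolume N R := by
        simp only [EuclideanSpace.volume_ball_fin_three, Finset.sum_const, Finset.card_univ,
          Fintype.card_fin, nsmul_eq_mul, encounterVolume]

/-! ### (5.15) from Lemma 4.1: the depletion is controlled by `T^out` and `|Ω^c|^{2/3} T` -/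

/-- The integrand of `T^out` for particle `i`, transported to the slice: on the cell,
`1_{Ω_{X,i}}(x) |∇(Ψ(…,xᵢ = ·,…))|²(x) = (1_{tᵢ ≥ R} |∇ᵢΨ|²)(…, xᵢ = x, …)`.
[cite: LSSY2005, Lemma 5.2 (5.12)] -/
theorem indicator_farSet_gradSqC_slice {N : ℕ} {Ψ : Config N → ℂ} (hΨ : Differentiable ℝ Ψ)
    (R : ℝ) (X : Config N) (i : Fin N) (x : Space) :
    (farSet R X i).indicator (gradSqC fun y => Ψ (Function.update X i y)) x =
      {Y : Config N | R ≤ nnDist Y i}.indicator (partialGradSq i Ψ) (Function.update X i x) := by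
  by_cases hx : x ∈ farSet R X i
  · rw [Set.indicator_of_mem hx, Set.indicator_of_mem (show Function.update X i x ∈
      {Y : Config N | R ≤ nnDist Y i} from hx), gradSqC_slice hΨ]
    rfl
  · rw [Set.indicator_of_notMem hx, Set.indicator_of_notMem (show Function.update X i x ∉
      {Y : Config N | R ≤ nnDist Y i} from hx)]

/-- Slice integrals of measurable `N`-body functions are measurable in the other variables.
[folklore] -/
theorem measurable_lintegral_cell_update {N : ℕ} (L : ℝ) (i : Fin N) {H : Config N → ℝ≥0∞}
    (hH : Measurable H) :
    Measurable fun X : Config N => ∫⁻ x in cell L, H (Function.update X i x) :=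
  (hH.comp measurable_update').lintegral_prod_right'

/-- **(5.15), structural part.** If the generalized Poincaré inequality (Lemma 4.1) holds with
constant `C`, then for every periodic `N`-body state on the cell of side `L` and every `R`,
`N - ⟨Ψ,n₀Ψ⟩ = depletion ≤ C (L² T^out + ((4π/3)NR³)^{2/3} T)` with
`T^out = ∫_{K^N} ∑ᵢ 1_{tᵢ ≥ R}|∇ᵢΨ|²` and `T = ∫_{K^N} |∇Ψ|²`: Lemma 4.1 applied to every slice
`xᵢ ↦ Ψ` with `Ω = Ω_{X,i}`, `|K ∖ Ω_{X,i}| ≤ (4π/3)NR³`, integrated over the other variables.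
[cite: LSSY2005, Ch. 5 (5.15)] -/
theorem depletion_le_of_lemma41 {C : ℝ}
    (h41 : ∀ (L : ℝ), 0 < L → ∀ (f : Space → ℂ), ContDiff ℝ 1 f →
      (∀ (x : Space) (k : Fin 3), f (x + EuclideanSpace.single k L) = f x) →
      ∀ (Ω : Set Space), MeasurableSet Ω → Ω ⊆ cell L →
        ∫⁻ x in cell L, (‖f x - ⨍ y in cell L, f y‖₊ : ℝ≥0∞) ^ 2 ≤
          ENNReal.ofReal C *
            (ENNReal.ofReal (L ^ 2) * (∫⁻ x in Ω, gradSqC f x) +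
              volume (cell L \ Ω) ^ (2 / 3 : ℝ) * ∫⁻ x in cell L, gradSqC f x))
    {N : ℕ} (hN : 1 < N) {L : ℝ} (hL : 0 < L) (R : ℝ) (Ψ : PeriodicTrialState N L) :
    depletion N L Ψ.ψ ≤ ENNReal.ofReal C *
      (ENNReal.ofReal (L ^ 2) * (∫⁻ X in cellN N L, kineticOutside R Ψ.ψ X) +
        encounterVolume N R ^ (2 / 3 : ℝ) * ∫⁻ X in cellN N L, kineticDensity Ψ.ψ X) := by
  have hL3 : ENNReal.ofReal L ^ 3 ≠ 0 := pow_ne_zero _ (by simpa using hL)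
  have hL3' : ENNReal.ofReal L ^ 3 ≠ ⊤ := ENNReal.pow_ne_top ENNReal.ofReal_ne_top
  have hdiff : Differentiable ℝ Ψ.ψ := Ψ.contDiff.differentiable one_ne_zero
  set G : Fin N → Config N → ℝ≥0∞ := fun i =>
    {Y : Config N | R ≤ nnDist Y i}.indicator (partialGradSq i Ψ.ψ) with hG
  have hGm : ∀ i, Measurable (G i) := fun i =>
    (measurable_partialGradSq i Ψ.ψ).indicator (measurableSet_le_nnDist R i)
  -- Lemma 4.1 on one slice, in transported form
  have hslice : ∀ (i : Fin N) (X : Config N),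
      ∫⁻ x in cell L, (‖Ψ.ψ (Function.update X i x) -
          ⨍ y in cell L, Ψ.ψ (Function.update X i y)‖₊ : ℝ≥0∞) ^ 2 ≤
        ENNReal.ofReal C *
          (ENNReal.ofReal (L ^ 2) * (∫⁻ x in cell L, G i (Function.update X i x)) +
            encounterVolume N R ^ (2 / 3 : ℝ) *
              ∫⁻ x in cell L, partialGradSq i Ψ.ψ (Function.update X i x)) := by
    intro i X
    have h := h41 L hL _ (Ψ.contDiff_slice X i) (Ψ.periodic_slice X i)
      (cell L ∩ farSet R X i) ((measurableSet_cell L).inter (measurableSet_farSet R X i))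
      Set.inter_subset_left
    refine h.trans ?_
    gcongr ENNReal.ofReal C * (ENNReal.ofReal (L ^ 2) * ?_ + ?_ * ?_)
    · -- `∫_{K ∩ Ω} |∇f|² = ∫_K 1_Ω |∇f|² = ∫_K G i ∘ update`
      refine le_of_eq ?_
      rw [Set.inter_comm, ← Measure.restrict_restrict (measurableSet_farSet R X i),
        ← lintegral_indicator (measurableSet_farSet R X i)]
      exact lintegral_congr fun x => indicator_farSet_gradSqC_slice hdiff R X i x
    · rw [Set.sdiff_self_inter]
      exact ENNReal.rpow_le_rpow (volume_cell_diff_farSet_le hN L R X i) (by norm_num)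
    · exact le_of_eq (lintegral_congr fun x => gradSqC_slice hdiff X i x)
  -- integrate over the other variables and sum over the particles
  have hEV : encounterVolume N R ^ (2 / 3 : ℝ) ≠ ⊤ :=
    ENNReal.rpow_ne_top_of_nonneg (by norm_num) (ENNReal.mul_ne_top (ENNReal.natCast_ne_top N)
      (ENNReal.mul_ne_top (ENNReal.pow_ne_top ENNReal.ofReal_ne_top) ENNReal.ofReal_ne_top))
  have hterm : ∀ i : Fin N, (ENNReal.ofReal L ^ 3)⁻¹ *
      ∫⁻ X in cellN N L, ∫⁻ x in cell L, (‖Ψ.ψ (Function.update X i x) -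
          ⨍ y in cell L, Ψ.ψ (Function.update X i y)‖₊ : ℝ≥0∞) ^ 2 ≤
        ENNReal.ofReal C *
          (ENNReal.ofReal (L ^ 2) * (∫⁻ X in cellN N L, G i X) +
            encounterVolume N R ^ (2 / 3 : ℝ) * ∫⁻ X in cellN N L, partialGradSq i Ψ.ψ X) := by
    intro i
    have hm : Measurable fun X : Config N => ENNReal.ofReal (L ^ 2) *
        ∫⁻ x in cell L, G i (Function.update X i x) :=
      (measurable_lintegral_cell_update L i (hGm i)).const_mul _
    calc (ENNReal.ofReal L ^ 3)⁻¹ *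
          ∫⁻ X in cellN N L, ∫⁻ x in cell L, (‖Ψ.ψ (Function.update X i x) -
            ⨍ y in cell L, Ψ.ψ (Function.update X i y)‖₊ : ℝ≥0∞) ^ 2
        ≤ (ENNReal.ofReal L ^ 3)⁻¹ * ∫⁻ X in cellN N L, ENNReal.ofReal C *
            (ENNReal.ofReal (L ^ 2) * (∫⁻ x in cell L, G i (Function.update X i x)) +
              encounterVolume N R ^ (2 / 3 : ℝ) *
                ∫⁻ x in cell L, partialGradSq i Ψ.ψ (Function.update X i x)) :=
          mul_le_mul_right (lintegral_mono fun X => hslice i X) _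
      _ = (ENNReal.ofReal L ^ 3)⁻¹ * (ENNReal.ofReal L ^ 3 * (ENNReal.ofReal C *
            (ENNReal.ofReal (L ^ 2) * (∫⁻ X in cellN N L, G i X) +
              encounterVolume N R ^ (2 / 3 : ℝ) * ∫⁻ X in cellN N L, partialGradSq i Ψ.ψ X))) := by
          rw [lintegral_const_mul' _ _ ENNReal.ofReal_ne_top, lintegral_add_left hm,
            lintegral_const_mul' _ _ ENNReal.ofReal_ne_top, lintegral_const_mul' _ _ hEV,
            lintegral_cellN_lintegral_update i (hGm i),
            lintegral_cellN_lintegral_update i (measurable_partialGradSq i Ψ.ψ),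
            mul_left_comm (ENNReal.ofReal (L ^ 2)), mul_left_comm (encounterVolume N R ^ (2 / 3 : ℝ)),
            ← mul_add, mul_left_comm (ENNReal.ofReal C)]
      _ = _ := by rw [← mul_assoc, ENNReal.inv_mul_cancel hL3 hL3', one_mul]
  -- sum over the particles
  have hsumG : ∑ i : Fin N, ∫⁻ X in cellN N L, G i X = ∫⁻ X in cellN N L, kineticOutside R Ψ.ψ X := by
    rw [← lintegral_finsetSum _ fun i _ => hGm i]
    rfl
  have hsumT : ∑ i : Fin N, ∫⁻ X in cellN N L, partialGradSq i Ψ.ψ X =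
      ∫⁻ X in cellN N L, kineticDensity Ψ.ψ X := by
    rw [← lintegral_finsetSum _ fun i _ => measurable_partialGradSq i Ψ.ψ]
    rfl
  calc depletion N L Ψ.ψ ≤ ∑ i : Fin N, ENNReal.ofReal C *
        (ENNReal.ofReal (L ^ 2) * (∫⁻ X in cellN N L, G i X) +
          encounterVolume N R ^ (2 / 3 : ℝ) * ∫⁻ X in cellN N L, partialGradSq i Ψ.ψ X) :=
        Finset.sum_le_sum fun i _ => hterm i
    _ = _ := by
        rw [← hsumG, ← hsumT, Finset.mul_sum, Finset.mul_sum, ← Finset.sum_add_distrib,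
          ← Finset.mul_sum]


/-! ### Inserting the energy bounds: Lemma 5.2 and an upper bound on `⟨Ψ, HΨ⟩` -/

/-- The real number `(4π/3) N R³`. [cite: LSSY2005, Ch. 5, after (5.15)] -/
def encounterVolumeReal (N : ℕ) (R : ℝ) : ℝ :=
  N * (R ^ 3 * (Real.pi * 4 / 3))

/-- `encounterVolume = ofReal encounterVolumeReal` for `R ≥ 0`. [folklore] -/
theorem encounterVolume_eq_ofReal (N : ℕ) {R : ℝ} (hR : 0 ≤ R) :
    encounterVolume N R = ENNReal.ofReal (encounterVolumeReal N R) := by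
  rw [encounterVolumeReal, encounterVolume, ENNReal.ofReal_mul (Nat.cast_nonneg N),
    ENNReal.ofReal_natCast, ENNReal.ofReal_mul (pow_nonneg hR 3), ENNReal.ofReal_pow hR]

/-- `0 ≤ (4π/3) N R³` for `R ≥ 0`. [folklore] -/
theorem encounterVolumeReal_nonneg (N : ℕ) {R : ℝ} (hR : 0 ≤ R) : 0 ≤ encounterVolumeReal N R := by
  unfold encounterVolumeReal; positivity

/-- **(5.15) with the energy bounds inserted.** Suppose Lemma 4.1 holds with constant `C₁ ≥ 0`,
that the state `Ψ` obeys the conclusion of Lemma 5.2 in the form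
`P + (1-θ) T^out ≤ ⟨Ψ, HΨ⟩` (`P = 4πρa(1-θ)N`, `θ = cY^{1/17} < 1`), and the energy bound
`⟨Ψ, HΨ⟩ ≤ U`. Then, since also `T ≤ ⟨Ψ,HΨ⟩ ≤ U`,
`N ≤ ⟨Ψ, n₀Ψ⟩ + C₁ (L² (U - P)/(1 - θ) + ((4π/3)NR³)^{2/3} U)`.
For the ground state `U = E₀ ≤ 4πρa(1 + cY^{1/3})N` by (2.14), which is (5.15)–(5.16) before
the limit is taken. [cite: LSSY2005, Ch. 5 (5.15)–(5.16)] -/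
theorem condensate_lower_bound {C₁ : ℝ} (hC₁ : 0 ≤ C₁)
    (h41 : ∀ (L : ℝ), 0 < L → ∀ (f : Space → ℂ), ContDiff ℝ 1 f →
      (∀ (x : Space) (k : Fin 3), f (x + EuclideanSpace.single k L) = f x) →
      ∀ (Ω : Set Space), MeasurableSet Ω → Ω ⊆ cell L →
        ∫⁻ x in cell L, (‖f x - ⨍ y in cell L, f y‖₊ : ℝ≥0∞) ^ 2 ≤
          ENNReal.ofReal C₁ *
            (ENNReal.ofReal (L ^ 2) * (∫⁻ x in Ω, gradSqC f x) +
              volume (cell L \ Ω) ^ (2 / 3 : ℝ) * ∫⁻ x in cell L, gradSqC f x))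
    {N : ℕ} (hN : 1 < N) {L : ℝ} (hL : 0 < L) {R θ P U : ℝ} (hR : 0 ≤ R) (hθ : θ < 1)
    (hP : 0 ≤ P) (hU : 0 ≤ U) (v : ℝ → ℝ≥0∞) (Ψ : PeriodicTrialState N L)
    (h52Ψ : ENNReal.ofReal P + ENNReal.ofReal (1 - θ) *
        (∫⁻ X in cellN N L, kineticOutside R Ψ.ψ X) ≤ periodicEnergy v Ψ)
    (hE : periodicEnergy v Ψ ≤ ENNReal.ofReal U) :
    (N : ℝ≥0∞) ≤ condensateOccupation N L Ψ.ψ +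
      ENNReal.ofReal (C₁ * (L ^ 2 * ((U - P) / (1 - θ)) +
        encounterVolumeReal N R ^ (2 / 3 : ℝ) * U)) := by
  obtain ⟨n, rfl⟩ : ∃ n, N = n + 1 := ⟨N - 1, (Nat.succ_pred_eq_of_pos (zero_lt_one.trans hN)).symm⟩
  have hθ' : 0 < 1 - θ := sub_pos.2 hθ
  have hPU : P ≤ U := by
    have : ENNReal.ofReal P ≤ ENNReal.ofReal U := (le_self_add.trans h52Ψ).trans hE
    exact (ENNReal.ofReal_le_ofReal_iff hU).1 this
  -- `T ≤ U`
  have hT : ∫⁻ X in cellN (n + 1) L, kineticDensity Ψ.ψ X ≤ ENNReal.ofReal U :=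
    (lintegral_mono fun X => le_self_add).trans hE
  -- `T^out ≤ (U - P)/(1 - θ)`
  have hTout : ∫⁻ X in cellN (n + 1) L, kineticOutside R Ψ.ψ X ≤
      ENNReal.ofReal ((U - P) / (1 - θ)) := by
    have h1 : ENNReal.ofReal (1 - θ) * ∫⁻ X in cellN (n + 1) L, kineticOutside R Ψ.ψ X ≤
        ENNReal.ofReal (U - P) := by
      rw [ENNReal.ofReal_sub _ hP]
      exact ENNReal.le_sub_of_add_le_left ENNReal.ofReal_ne_top (h52Ψ.trans hE)
    rw [ENNReal.ofReal_div_of_pos hθ', ENNReal.le_div_iff_mul_le (Or.inl (by simpa using hθ'))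
      (Or.inl ENNReal.ofReal_ne_top), mul_comm]
    exact h1
  have hEV : encounterVolume (n + 1) R ^ (2 / 3 : ℝ) =
      ENNReal.ofReal (encounterVolumeReal (n + 1) R ^ (2 / 3 : ℝ)) := by
    rw [encounterVolume_eq_ofReal _ hR,
      ENNReal.ofReal_rpow_of_nonneg (encounterVolumeReal_nonneg _ hR) (by norm_num)]
  have hdep := depletion_le_of_lemma41 h41 hN hL R Ψ
  have hUP : 0 ≤ (U - P) / (1 - θ) := div_nonneg (sub_nonneg.2 hPU) hθ'.le
  have hEVr : 0 ≤ encounterVolumeReal (n + 1) R ^ (2 / 3 : ℝ) :=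
    Real.rpow_nonneg (encounterVolumeReal_nonneg _ hR) _
  calc ((n + 1 : ℕ) : ℝ≥0∞) = condensateOccupation (n + 1) L Ψ.ψ + depletion (n + 1) L Ψ.ψ :=
        (condensateOccupation_add_depletion hL Ψ).symm
    _ ≤ condensateOccupation (n + 1) L Ψ.ψ + ENNReal.ofReal C₁ *
          (ENNReal.ofReal (L ^ 2) * ENNReal.ofReal ((U - P) / (1 - θ)) +
            ENNReal.ofReal (encounterVolumeReal (n + 1) R ^ (2 / 3 : ℝ)) * ENNReal.ofReal U) := by
        rw [← hEV]
        gcongr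
        calc depletion (n + 1) L Ψ.ψ ≤ _ := hdep
          _ ≤ _ := by gcongr
    _ = _ := by
        rw [← ENNReal.ofReal_mul (sq_nonneg L), ← ENNReal.ofReal_mul hEVr,
          ← ENNReal.ofReal_add (mul_nonneg (sq_nonneg L) hUP) (mul_nonneg hEVr hU),
          ← ENNReal.ofReal_mul hC₁]

/-- From `N ≤ n₀ + η` and `η ≤ εN` to `(1 - ε) N ≤ n₀`. [folklore] -/
theorem ofReal_one_sub_mul_le {N : ℕ} {n₀ : ℝ≥0∞} {η ε : ℝ} (hε : 0 ≤ ε)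
    (h : (N : ℝ≥0∞) ≤ n₀ + ENNReal.ofReal η) (hη : η ≤ ε * N) :
    ENNReal.ofReal (1 - ε) * N ≤ n₀ := by
  rcases le_or_gt 1 ε with hε1 | hε1
  · rw [ENNReal.ofReal_of_nonpos (sub_nonpos.2 hε1), zero_mul]
    exact bot_le
  have hsplit : (N : ℝ≥0∞) = ENNReal.ofReal (1 - ε) * N + ENNReal.ofReal (ε * N) := by
    rw [← ENNReal.ofReal_natCast, ← ENNReal.ofReal_mul (sub_nonneg.2 hε1.le),
      ← ENNReal.ofReal_add (mul_nonneg (sub_nonneg.2 hε1.le) (Nat.cast_nonneg N))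
        (mul_nonneg hε (Nat.cast_nonneg N))]
    congr 1; ring
  refine ENNReal.le_of_add_le_add_right ENNReal.ofReal_ne_top (hsplit ▸ h.trans ?_)
  gcongr


/-! ### The Gross–Pitaevskii limit in the fixed-potential picture -/

/-- `⟨Ψ, n₀Ψ⟩ ≤ N` for every periodic state (also for `N = 0`). [cite: LSSY2005, Ch. 5 (5.17)] -/
theorem condensateOccupation_le_card {N : ℕ} {L : ℝ} (hL : 0 < L) (Ψ : PeriodicTrialState N L) :
    condensateOccupation N L Ψ.ψ ≤ (N : ℝ≥0∞) := by
  cases N with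
  | zero => simp [condensateOccupation, occupation]
  | succ n => exact condensateOccupation_le hL Ψ

/-- Power-counting in `N`: `N^p (κ/N²)^q → 0` when `p < 2q` (`κ > 0`), the form of every
error term of (5.15)–(5.16) in the GP limit, where `Y = κ/N²` with `κ = 4πg³/3`. [folklore] -/
theorem tendsto_rpow_mul_div_sq_rpow {κ : ℝ} (hκ : 0 < κ) {p q : ℝ} (hpq : p - 2 * q < 0) :
    Tendsto (fun N : ℕ => (N : ℝ) ^ p * (κ / (N : ℝ) ^ 2) ^ q) atTop (𝓝 0) := by
  have hlim : Tendsto (fun N : ℕ => κ ^ q * (N : ℝ) ^ (-(2 * q - p))) atTop (𝓝 (κ ^ q * 0)) :=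
    ((tendsto_rpow_neg_atTop (by linarith)).comp tendsto_natCast_atTop_atTop).const_mul _
  rw [mul_zero] at hlim
  refine hlim.congr' ?_
  filter_upwards [eventually_gt_atTop 0] with N hN
  have hN' : (0 : ℝ) < N := Nat.cast_pos.2 hN
  rw [Real.div_rpow hκ.le (sq_nonneg _), show ((N : ℝ) ^ 2) ^ q = (N : ℝ) ^ (2 * q) by
    rw [← Real.rpow_natCast, ← Real.rpow_mul hN'.le]; norm_num, neg_sub,
    Real.rpow_sub hN', mul_div_assoc', mul_comm (κ ^ q), mul_div_assoc]

/-- The density of the rescaled GP box: `N/(N/g)³ = g³/N²` (both sides `0` at `N = 0`).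
[cite: LSSY2005, Ch. 5, footnote to (5.3)] -/
theorem density_gp_box (g : ℝ) (N : ℕ) : (N : ℝ) / ((N : ℝ) / g) ^ 3 = g ^ 3 / (N : ℝ) ^ 2 := by
  rcases eq_or_ne g 0 with rfl | hg
  · cases N <;> simp
  rcases Nat.eq_zero_or_pos N with rfl | hN
  · simp
  have hN' : (N : ℝ) ≠ 0 := Nat.cast_ne_zero.2 hN.ne'
  field_simp

/-- **Upper bound `⟨φ₀, γφ₀⟩ ≤ N` for the ground state**, eventually in `N`: once the periodic
ground-state energy is finite (Thm. 2.2: `N ≥ 2`, `2R₀ < L`, `a/b ≤ c`), near-minimisers exist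
and each has `⟨Ψ, n₀Ψ⟩ ≤ N`. [cite: LSSY2005, Thm. 2.2 (2.14) and Ch. 5 (5.17)] -/
theorem eventually_periodicCondensateNumber_le (v₁ : ℝ → ℝ≥0∞) (hv₁ : IsRepulsiveFiniteRange v₁)
    (ha : scatteringLength v₁ ≠ ⊤) {g : ℝ} (hg : 0 < g) :
    ∀ᶠ N : ℕ in atTop, periodicCondensateNumber v₁ N (N / g) ≤ (N : ℝ≥0∞) := by
  obtain ⟨hmeas, R₀, hvan⟩ := hv₁
  obtain ⟨C, c, -, hc, H⟩ := LSSY2005_upperBound_periodic_holds v₁ R₀ hmeas hvan ha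
  set a : ℝ := (scatteringLength v₁).toReal with ha_def
  -- `a/b = a (4πρ₁/3)^{1/3} → 0`
  have hρ₁ : Tendsto (fun N : ℕ => 4 * Real.pi * (((N : ℝ) - 1) / ((N : ℝ) / g) ^ 3) / 3)
      atTop (𝓝 0) := by
    have h0 : Tendsto (fun N : ℕ => 4 * Real.pi * ((N : ℝ) ^ (0 : ℝ) *
        (g ^ 3 / (N : ℝ) ^ 2) ^ (1 : ℝ)) / 3) atTop (𝓝 (4 * Real.pi * 0 / 3)) :=
      ((tendsto_rpow_mul_div_sq_rpow (by positivity) (by norm_num)).const_mul _).div_const _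
    rw [mul_zero, zero_div] at h0
    refine tendsto_of_tendsto_of_tendsto_of_le_of_le' tendsto_const_nhds h0 ?_ ?_
    · filter_upwards [eventually_ge_atTop 1] with N hN
      have h1 : (0 : ℝ) ≤ N - 1 := by
        have : (1 : ℝ) ≤ N := by exact_mod_cast hN
        linarith
      have hM : 0 < (N : ℝ) / g := div_pos (by linarith) hg
      exact div_nonneg (mul_nonneg (by positivity) (div_nonneg h1 (pow_nonneg hM.le 3)))
        (by norm_num)
    · filter_upwards [eventually_ge_atTop 1] with N hN
      have hN' : (0 : ℝ) < N := by exact_mod_cast hN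
      have hM : 0 < (N : ℝ) / g := div_pos hN' hg
      rw [Real.rpow_zero, one_mul, Real.rpow_one, ← density_gp_box g N]
      gcongr
      linarith
  have hab : Tendsto (fun N : ℕ => a / (4 * Real.pi * (((N : ℝ) - 1) / ((N : ℝ) / g) ^ 3) / 3) ^
      (-(1 : ℝ) / 3)) atTop (𝓝 0) := by
    have h1 : Tendsto (fun N : ℕ => a * (4 * Real.pi * (((N : ℝ) - 1) / ((N : ℝ) / g) ^ 3) / 3) ^
        ((1 : ℝ) / 3)) atTop (𝓝 (a * (0 : ℝ) ^ ((1 : ℝ) / 3))) :=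
      (hρ₁.rpow_const (Or.inr (by norm_num))).const_mul a
    rw [Real.zero_rpow (by norm_num), mul_zero] at h1
    refine h1.congr' ?_
    filter_upwards [eventually_ge_atTop 1] with N hN
    have h1 : (0 : ℝ) ≤ N - 1 := by
      have : (1 : ℝ) ≤ N := by exact_mod_cast hN
      linarith
    have hM : 0 < (N : ℝ) / g := div_pos (by linarith) hg
    have hbase : 0 ≤ 4 * Real.pi * (((N : ℝ) - 1) / ((N : ℝ) / g) ^ 3) / 3 :=
      div_nonneg (mul_nonneg (by positivity) (div_nonneg h1 (pow_nonneg hM.le 3))) (by norm_num)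
    rw [show (-(1 : ℝ) / 3) = -(1 / 3) by norm_num, Real.rpow_neg hbase, div_inv_eq_mul]
  filter_upwards [eventually_ge_atTop 2, (tendsto_natCast_atTop_atTop.atTop_div_const hg).eventually_gt_atTop (2 * R₀),
    hab.eventually_le_const hc] with N h2 hR₀ habc
  have hL : 0 < (N : ℝ) / g := div_pos (by exact_mod_cast (zero_lt_two.trans_le h2)) hg
  have hE₀ : periodicGroundStateEnergy v₁ N (N / g) ≠ ⊤ :=
    ne_top_of_le_ne_top ENNReal.ofReal_ne_top (H N _ h2 hL hR₀ habc)
  refine iSup₂_le fun δ hδ => ?_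
  have hlt : periodicGroundStateEnergy v₁ N (N / g) < periodicGroundStateEnergy v₁ N (N / g) + δ :=
    ENNReal.lt_add_right hE₀ hδ.ne'
  obtain ⟨Ψ, hΨ⟩ := iInf_lt_iff.1 hlt
  exact (iInf₂_le Ψ hΨ.le).trans (condensateOccupation_le_card hL Ψ)


/-! ### The GP bookkeeping: `L = N/g`, `ρ = g³/N²`, `Y = 4πg³/(3N²)` -/

/-- The side `L_N = N/g` of the rescaled GP box (fixed potential of scattering length `1`,
`Na/L = g`). [cite: LSSY2005, Ch. 5, remark after Thm. 5.1] -/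
def gpL (g : ℝ) (N : ℕ) : ℝ := N / g

/-- The density `ρ = N/L_N³` of the rescaled GP box. [cite: LSSY2005, Ch. 5, footnote to (5.3)] -/
def gpρ (g : ℝ) (N : ℕ) : ℝ := N / gpL g N ^ 3

/-- The reduced density `ρ₁ = (N-1)/L_N³` of Thm. 2.2. [cite: LSSY2005, Thm. 2.2] -/
def gpρ₁ (g : ℝ) (N : ℕ) : ℝ := ((N : ℝ) - 1) / gpL g N ^ 3

/-- The diluteness parameter `Y = 4πρa³/3` of the rescaled GP box (`a = 1`).
[cite: LSSY2005, Thm. 2.4 and Ch. 5] -/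
def gpY (g : ℝ) (N : ℕ) : ℝ := 4 * Real.pi * gpρ g N / 3

/-- The length `b = (4πρ₁/3)^{-1/3}` of Thm. 2.2 for the rescaled GP box (junk value
`0 ^ (-1/3)` at `N ≤ 1`, where `ρ₁ = 0`; only its eventual behaviour `1/b → 0` is used).
[cite: LSSY2005, Thm. 2.2] -/
def gpb (g : ℝ) (N : ℕ) : ℝ := (4 * Real.pi * gpρ₁ g N / 3) ^ (-(1 : ℝ) / 3)

section GP

variable {g : ℝ}

/-- `ρ = g³/N²`. [cite: LSSY2005, Ch. 5, footnote to (5.3)] -/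
theorem gpρ_eq (g : ℝ) (N : ℕ) : gpρ g N = g ^ 3 / (N : ℝ) ^ 2 := density_gp_box g N

/-- `Y = (4πg³/3)/N²`. [cite: LSSY2005, Ch. 5 ("`ρa³ ∼ N⁻²` in the GP limit")] -/
theorem gpY_eq (g : ℝ) (N : ℕ) : gpY g N = (4 * Real.pi * g ^ 3 / 3) / (N : ℝ) ^ 2 := by
  rw [gpY, gpρ_eq]; ring

/-- `ρ₁ = ρ (N-1)/N` (`N ≥ 1`). [cite: LSSY2005, Thm. 2.2] -/
theorem gpρ₁_eq (g : ℝ) {N : ℕ} (hN : 0 < N) : gpρ₁ g N = gpρ g N * (((N : ℝ) - 1) / N) := by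
  have hN' : (N : ℝ) ≠ 0 := Nat.cast_ne_zero.2 hN.ne'
  rw [gpρ₁, gpρ, div_mul_div_comm, mul_comm _ ((N : ℝ) - 1), ← div_mul_div_comm, div_self hN',
    mul_one]

/-- `ρ L² = g` (`N ≥ 1`, `g ≠ 0`): the GP coupling `ρaL²` is fixed. [cite: LSSY2005, Thm. 5.1] -/
theorem gpρ_mul_sq (hg : g ≠ 0) {N : ℕ} (hN : 0 < N) : gpρ g N * gpL g N ^ 2 = g := by
  have hN' : (N : ℝ) ≠ 0 := Nat.cast_ne_zero.2 hN.ne'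
  rw [gpρ, gpL]
  field_simp

/-- `L_N > 0`. [folklore] -/
theorem gpL_pos (hg : 0 < g) {N : ℕ} (hN : 0 < N) : 0 < gpL g N :=
  div_pos (Nat.cast_pos.2 hN) hg

/-- `Y > 0` for `N ≥ 1`. [folklore] -/
theorem gpY_pos (hg : 0 < g) {N : ℕ} (hN : 0 < N) : 0 < gpY g N := by
  rw [gpY_eq]; positivity

/-- `ρ₁ ≥ 0` for `N ≥ 1`. [folklore] -/
theorem gpρ₁_nonneg (hg : 0 < g) {N : ℕ} (hN : 0 < N) : 0 ≤ gpρ₁ g N := by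
  have : (1 : ℝ) ≤ N := by exact_mod_cast hN
  exact div_nonneg (by linarith) (pow_nonneg (gpL_pos hg hN).le 3)

/-- `Y → 0` in the GP limit. [cite: LSSY2005, Ch. 5 (proof of Thm. 5.1: "while `Y → 0`")] -/
theorem tendsto_gpY (g : ℝ) : Tendsto (gpY g) atTop (𝓝 0) := by
  have h := tendsto_const_nhds.div_atTop (a := 4 * Real.pi * g ^ 3 / 3)
    ((tendsto_pow_atTop two_ne_zero).comp (tendsto_natCast_atTop_atTop (R := ℝ)))
  refine h.congr fun N => ?_
  rw [gpY_eq]; rfl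

/-- `1/b = (4πρ₁/3)^{1/3} → 0` in the GP limit (so `a/b ≤ c` eventually). [cite: LSSY2005, Thm. 2.2] -/
theorem tendsto_one_div_gpb (hg : 0 < g) : Tendsto (fun N => 1 / gpb g N) atTop (𝓝 0) := by
  have hρ₁ : Tendsto (fun N : ℕ => 4 * Real.pi * gpρ₁ g N / 3) atTop (𝓝 0) := by
    have h0 : Tendsto (fun N : ℕ => gpY g N * (((N : ℝ) - 1) / N)) atTop (𝓝 (0 * (1 - 0))) := by
      refine (tendsto_gpY g).mul ?_
      have h := (tendsto_inv_atTop_nhds_zero_nat (𝕜 := ℝ)).const_sub (1 : ℝ)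
      refine h.congr' ?_
      filter_upwards [eventually_gt_atTop 0] with N hN
      have hN' : (N : ℝ) ≠ 0 := Nat.cast_ne_zero.2 hN.ne'
      field_simp
    rw [zero_mul] at h0
    refine h0.congr' ?_
    filter_upwards [eventually_gt_atTop 0] with N hN
    rw [gpρ₁_eq g hN, gpY]; ring
  have h1 : Tendsto (fun N : ℕ => (4 * Real.pi * gpρ₁ g N / 3) ^ ((1 : ℝ) / 3)) atTop
      (𝓝 ((0 : ℝ) ^ ((1 : ℝ) / 3))) := hρ₁.rpow_const (Or.inr (by norm_num))
  rw [Real.zero_rpow (by norm_num)] at h1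
  refine h1.congr' ?_
  filter_upwards [eventually_gt_atTop 0] with N hN
  have hbase : 0 ≤ 4 * Real.pi * gpρ₁ g N / 3 := by
    have := gpρ₁_nonneg hg hN; positivity
  rw [gpb, show (-(1 : ℝ) / 3) = -(1 / 3) by norm_num, Real.rpow_neg hbase, div_inv_eq_mul, one_mul]

/-- `Y^{-1/17} ≤ N` eventually (the hypothesis `N ≥ Y^{-1/17}` of Lemma 5.2 holds in the GP
limit, where `Y^{-1/17} ∼ N^{2/17}`). [cite: LSSY2005, Lemma 5.2] -/
theorem eventually_gpY_rpow_le (hg : 0 < g) :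
    ∀ᶠ N : ℕ in atTop, gpY g N ^ (-(1 : ℝ) / 17) ≤ N := by
  have h := tendsto_rpow_mul_div_sq_rpow (κ := 4 * Real.pi * g ^ 3 / 3) (by positivity)
    (p := -1) (q := -(1 : ℝ) / 17) (by norm_num)
  filter_upwards [h.eventually_le_const zero_lt_one, eventually_gt_atTop 0] with N hN hN0
  have hN' : (0 : ℝ) < N := Nat.cast_pos.2 hN0
  rw [← gpY_eq, Real.rpow_neg_one, inv_mul_le_iff₀ hN', mul_one] at hN
  exact hN

/-- `N^{2/3} Y^{7/17} → 0` (the volume error `|Ω^c|^{2/3} T/N ∼ N^{2/3}Y^{7/17} = O(N^{-8/51})`).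
[cite: LSSY2005, Ch. 5 (5.15)] -/
theorem tendsto_rpow_mul_gpY_rpow (hg : 0 < g) :
    Tendsto (fun N : ℕ => (N : ℝ) ^ ((2 : ℝ) / 3) * gpY g N ^ ((7 : ℝ) / 17)) atTop (𝓝 0) := by
  have h := tendsto_rpow_mul_div_sq_rpow (κ := 4 * Real.pi * g ^ 3 / 3) (by positivity)
    (p := (2 : ℝ) / 3) (q := (7 : ℝ) / 17) (by norm_num)
  refine h.congr fun N => ?_
  rw [gpY_eq]

/-- **The algebra of (5.16).** With `U = 4πρ₁(1 + C₂s)N + 4πρθN` (energy bound of a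
`δ`-near-minimiser, `δ = 4πρθN`), `P = 4πρ(1-θ)N`, `R = Y^{-5/17}`: after division by `N` the
error `C₁(L²(U-P)/(1-θ) + ((4π/3)NR³)^{2/3}U)` of `condensate_lower_bound` is
`C₁(4πg (t(1+C₂s) + θ - (1-θ))/(1-θ) + (4π/3)^{2/3}·3·(N^{2/3}Y^{7/17})·(t(1+C₂s)+θ))`,
`t = (N-1)/N` — "the terms `4πμρaL²` on both sides cancel", `ρaL² = g`. [cite: LSSY2005, Ch. 5 (5.16)] -/
theorem gp_error_eq (hg : 0 < g) {N : ℕ} (hN : 0 < N) (C₁ C₂ s : ℝ) {θ : ℝ} (hθ : θ < 1) :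
    C₁ * (gpL g N ^ 2 * ((4 * Real.pi * gpρ₁ g N * (1 + C₂ * s) * N +
        4 * Real.pi * gpρ g N * θ * N - 4 * Real.pi * gpρ g N * (1 - θ) * N) / (1 - θ)) +
      encounterVolumeReal N (gpY g N ^ (-(5 : ℝ) / 17)) ^ ((2 : ℝ) / 3) *
        (4 * Real.pi * gpρ₁ g N * (1 + C₂ * s) * N + 4 * Real.pi * gpρ g N * θ * N)) =
    N * (C₁ * (4 * Real.pi * g * (((((N : ℝ) - 1) / N) * (1 + C₂ * s) + θ - (1 - θ)) / (1 - θ)) +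
      (Real.pi * 4 / 3) ^ ((2 : ℝ) / 3) * 3 * ((N : ℝ) ^ ((2 : ℝ) / 3) * gpY g N ^ ((7 : ℝ) / 17)) *
        ((((N : ℝ) - 1) / N) * (1 + C₂ * s) + θ))) := by
  have hN' : (N : ℝ) ≠ 0 := Nat.cast_ne_zero.2 hN.ne'
  have hNpos : (0 : ℝ) < N := Nat.cast_pos.2 hN
  have hY := gpY_pos hg hN
  set R : ℝ := gpY g N ^ (-(5 : ℝ) / 17) with hR
  have hR0 : 0 ≤ R := Real.rpow_nonneg hY.le _
  -- `((4π/3) N R³)^{2/3} = N^{2/3} R² (4π/3)^{2/3}`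
  have hEV : encounterVolumeReal N R ^ ((2 : ℝ) / 3) =
      (N : ℝ) ^ ((2 : ℝ) / 3) * R ^ 2 * (Real.pi * 4 / 3) ^ ((2 : ℝ) / 3) := by
    rw [encounterVolumeReal, Real.mul_rpow hNpos.le (by positivity),
      Real.mul_rpow (pow_nonneg hR0 3) (by positivity), mul_assoc]
    congr 2
    rw [← Real.rpow_natCast, ← Real.rpow_mul hR0]
    norm_num
  -- `R² Y = Y^{7/17}`
  have hRY : R ^ 2 * gpY g N = gpY g N ^ ((7 : ℝ) / 17) := by
    rw [hR, ← Real.rpow_natCast, ← Real.rpow_mul hY.le, ← Real.rpow_add_one hY.ne']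
    norm_num
  -- `ρ₁ = ρ t`, `ρ L² = g`, `4πρ = 3Y`
  rw [hEV, ← hRY, gpρ₁_eq g hN]
  have hρL := gpρ_mul_sq hg.ne' hN
  have h3Y : 4 * Real.pi * gpρ g N = 3 * gpY g N := by rw [gpY]; ring
  -- now a polynomial identity in the atoms
  set ρ := gpρ g N
  set L := gpL g N
  set Y := gpY g N
  set A := (N : ℝ) ^ ((2 : ℝ) / 3)
  set c₀ := (Real.pi * 4 / 3) ^ ((2 : ℝ) / 3)
  have hθ' : (1 - θ) ≠ 0 := (sub_pos.2 hθ).ne'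
  have hYρ : Y = 4 * Real.pi * ρ / 3 := by linarith [h3Y]
  rw [← hρL, hYρ]
  field_simp

end GP


/-! ### Theorem 5.1 from the two lemmas -/

/-- **The lower bound `⟨φ₀, γφ₀⟩ ≥ (1 - ε)N`, eventually in `N`** (fixed potential `v₁` of
scattering length `1`, box `L_N = N/g`): for large `N` choose `δ = 4πρθN` (`θ = cY^{1/17}`);
every `δ`-near-minimiser `Ψ` has `⟨Ψ,HΨ⟩ ≤ 4πρ₁(1 + C a/b)N + δ` by (2.14), satisfies Lemma 5.2,
and `condensate_lower_bound` with `gp_error_eq` gives `N ≤ ⟨Ψ,n₀Ψ⟩ + NΦ_N` with `Φ_N → 0`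
(`tendsto_gpY`, `tendsto_one_div_gpb`, `tendsto_rpow_mul_gpY_rpow`).
[cite: LSSY2005, Ch. 5 (5.15)–(5.16)] -/
theorem eventually_le_periodicCondensateNumber {C₁ : ℝ} (hC₁ : 0 ≤ C₁)
    (h41 : ∀ (L : ℝ), 0 < L → ∀ (f : Space → ℂ), ContDiff ℝ 1 f →
      (∀ (x : Space) (k : Fin 3), f (x + EuclideanSpace.single k L) = f x) →
      ∀ (Ω : Set Space), MeasurableSet Ω → Ω ⊆ cell L →
        ∫⁻ x in cell L, (‖f x - ⨍ y in cell L, f y‖₊ : ℝ≥0∞) ^ 2 ≤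
          ENNReal.ofReal C₁ *
            (ENNReal.ofReal (L ^ 2) * (∫⁻ x in Ω, gradSqC f x) +
              volume (cell L \ Ω) ^ (2 / 3 : ℝ) * ∫⁻ x in cell L, gradSqC f x))
    (h52 : LSSY2005_lemma52_periodic) (v₁ : ℝ → ℝ≥0∞) (hv₁ : IsRepulsiveFiniteRange v₁)
    (ha1 : scatteringLength v₁ = 1) {g : ℝ} (hg : 0 < g) {ε : ℝ} (hε : 0 < ε) :
    ∀ᶠ N : ℕ in atTop,
      ENNReal.ofReal (1 - ε) * N ≤ periodicCondensateNumber v₁ N (gpL g N) := by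
  obtain ⟨hmeas, R₀, hvan⟩ := id hv₁
  have ha : scatteringLength v₁ ≠ ⊤ := by rw [ha1]; exact ENNReal.one_ne_top
  have ha' : (scatteringLength v₁).toReal = 1 := by rw [ha1, ENNReal.toReal_one]
  obtain ⟨C₅, hC₅, H52⟩ := h52 v₁ hv₁ ha
  obtain ⟨C₂, c, hC₂, hc, H22⟩ := LSSY2005_upperBound_periodic_holds v₁ R₀ hmeas hvan ha
  -- the vanishing sequences
  set θ : ℕ → ℝ := fun N => C₅ * gpY g N ^ ((1 : ℝ) / 17) with hθdef
  set s : ℕ → ℝ := fun N => 1 / gpb g N with hsdef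
  set t : ℕ → ℝ := fun N => ((N : ℝ) - 1) / N with htdef
  set u : ℕ → ℝ := fun N => (N : ℝ) ^ ((2 : ℝ) / 3) * gpY g N ^ ((7 : ℝ) / 17) with hudef
  set Φ : ℕ → ℝ := fun N => C₁ * (4 * Real.pi * g *
      ((t N * (1 + C₂ * s N) + θ N - (1 - θ N)) / (1 - θ N)) +
    (Real.pi * 4 / 3) ^ ((2 : ℝ) / 3) * 3 * u N * (t N * (1 + C₂ * s N) + θ N)) with hΦdef
  have hθlim : Tendsto θ atTop (𝓝 0) := by
    have h := ((tendsto_gpY g).rpow_const (p := (1 : ℝ) / 17) (Or.inr (by norm_num))).const_mul C₅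
    rw [Real.zero_rpow (by norm_num), mul_zero] at h
    exact h
  have hslim : Tendsto s atTop (𝓝 0) := tendsto_one_div_gpb hg
  have htlim : Tendsto t atTop (𝓝 1) := by
    have h := (tendsto_inv_atTop_nhds_zero_nat (𝕜 := ℝ)).const_sub (1 : ℝ)
    rw [sub_zero] at h
    refine h.congr' ?_
    filter_upwards [eventually_gt_atTop 0] with N hN
    have hN' : (N : ℝ) ≠ 0 := Nat.cast_ne_zero.2 hN.ne'
    simp only [htdef]
    field_simp
  have hulim : Tendsto u atTop (𝓝 0) := tendsto_rpow_mul_gpY_rpow hg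
  have hΦlim : Tendsto Φ atTop (𝓝 0) := by
    have hA : Tendsto (fun N => t N * (1 + C₂ * s N) + θ N) atTop (𝓝 1) := by
      have h := (htlim.mul ((hslim.const_mul C₂).const_add 1)).add hθlim
      simp only [mul_zero, add_zero, mul_one] at h
      exact h
    have hB : Tendsto (fun N => 1 - θ N) atTop (𝓝 1) := by
      have h := hθlim.const_sub 1
      rw [sub_zero] at h
      exact h
    have hC : Tendsto (fun N => (t N * (1 + C₂ * s N) + θ N - (1 - θ N)) / (1 - θ N))
        atTop (𝓝 0) := by
      have h := (hA.sub hB).div hB one_ne_zero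
      rw [sub_self, zero_div] at h
      exact h
    have hD : Tendsto (fun N => (Real.pi * 4 / 3) ^ ((2 : ℝ) / 3) * 3 * u N *
        (t N * (1 + C₂ * s N) + θ N)) atTop (𝓝 0) := by
      have h := (hulim.const_mul ((Real.pi * 4 / 3) ^ ((2 : ℝ) / 3) * 3)).mul hA
      rw [mul_zero, zero_mul] at h
      simpa only [mul_assoc] using h
    have h := ((hC.const_mul (4 * Real.pi * g)).add hD).const_mul C₁
    rw [mul_zero, zero_add, mul_zero] at h
    exact h
  -- the eventual conditions
  filter_upwards [eventually_ge_atTop 2, eventually_gpY_rpow_le hg,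
    hθlim.eventually_le_const (show (0 : ℝ) < 1 / 2 by norm_num),
    ((tendsto_natCast_atTop_atTop (R := ℝ)).atTop_div_const hg).eventually_gt_atTop (2 * R₀),
    hslim.eventually_le_const hc, hΦlim.eventually_le_const hε] with N h2 hY17 hθhalf hR₀ hsc hΦε
  have hN0 : 0 < N := zero_lt_two.trans_le h2
  have hNr : (0 : ℝ) < N := Nat.cast_pos.2 hN0
  have hL : 0 < gpL g N := gpL_pos hg hN0
  have hY : 0 < gpY g N := gpY_pos hg hN0
  have hρ : 0 < gpρ g N := by rw [gpρ_eq]; positivity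
  have hρ₁ : 0 ≤ gpρ₁ g N := gpρ₁_nonneg hg hN0
  have hθ0 : 0 < θ N := mul_pos hC₅ (Real.rpow_pos_of_pos hY _)
  have hθ1 : θ N < 1 := hθhalf.trans_lt (by norm_num)
  have hs0 : 0 ≤ s N := by
    simp only [hsdef, gpb]
    exact div_nonneg zero_le_one (Real.rpow_nonneg (by positivity) _)
  have ht0 : 0 ≤ t N := by
    have : (1 : ℝ) ≤ N := by exact_mod_cast hN0
    exact div_nonneg (by linarith) hNr.le
  -- `δ = 4πρθN` and the near-minimisers
  have hδr : 0 < 4 * Real.pi * gpρ g N * θ N * N := by positivity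
  refine le_periodicCondensateNumber v₁ (ENNReal.ofReal_pos.2 hδr) fun Ψ hΨ => ?_
  -- the energy upper bound (2.14) for the near-minimiser
  have hup := H22 N (gpL g N) h2 hL hR₀
  dsimp only at hup
  rw [ha'] at hup
  have hU0 : 0 ≤ 4 * Real.pi * gpρ₁ g N * (1 + C₂ * s N) * N := by positivity
  have hE₀ : periodicGroundStateEnergy v₁ N (gpL g N) ≤
      ENNReal.ofReal (4 * Real.pi * gpρ₁ g N * 1 * (1 + C₂ * s N) * N) := hup hsc
  rw [mul_one] at hE₀
  have hE : periodicEnergy v₁ Ψ ≤ ENNReal.ofReal (4 * Real.pi * gpρ₁ g N * (1 + C₂ * s N) * N +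
      4 * Real.pi * gpρ g N * θ N * N) := by
    refine hΨ.trans ?_
    rw [ENNReal.ofReal_add hU0 hδr.le]
    gcongr
  -- Lemma 5.2 for `Ψ`
  have h5 := H52 N (gpL g N) hL
  dsimp only at h5
  rw [ha'] at h5
  simp only [one_pow, mul_one, one_mul] at h5
  have h52Ψ : ENNReal.ofReal (4 * Real.pi * gpρ g N * (1 - θ N) * N) +
      ENNReal.ofReal (1 - θ N) * (∫⁻ X in cellN N (gpL g N),
        kineticOutside (gpY g N ^ (-(5 : ℝ) / 17)) Ψ.ψ X) ≤ periodicEnergy v₁ Ψ := h5 hY17 Ψ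
  -- (5.15) with the bounds inserted, and the algebra of (5.16)
  have key := condensate_lower_bound hC₁ h41 h2 hL (Real.rpow_nonneg hY.le _) hθ1
    (by positivity : (0 : ℝ) ≤ 4 * Real.pi * gpρ g N * (1 - θ N) * N) (add_nonneg hU0 hδr.le)
    v₁ Ψ h52Ψ hE
  have hη := gp_error_eq hg hN0 C₁ C₂ (s N) hθ1
  refine ofReal_one_sub_mul_le hε.le key ?_
  calc _ = N * Φ N := hη
    _ ≤ N * ε := mul_le_mul_of_nonneg_left hΦε hNr.le
    _ = ε * N := mul_comm _ _

/-- **LSSY Theorem 5.1 (periodic case) from Lemma 4.1 and Lemma 5.2.** If the generalized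
Poincaré inequality for periodic `C¹` functions on the cell (`LSSY2005_lemma41_periodic`,
[LSSY2005, Lemma 4.1 (4.2)]) and the energy-localization Lemma 5.2
(`LSSY2005_lemma52_periodic`) hold, then the ground state
of the dilute Bose gas in the Gross–Pitaevskii limit (`N → ∞`, `ρ` and `g = Na/L` fixed,
periodic box) is completely Bose–Einstein condensed: `N⁻¹L⁻³∬γ → 1` (5.4). The upper bound
(2.14) used in the printed proof is the tree's `LSSY2005_upperBound_periodic_holds`; the scaling
to a fixed potential is `periodicCondensateNumber_gp_eq`. [cite: LSSY2005, Thm. 5.1 (5.4)] -/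
theorem LSSY2005_thm51_periodic_of_lemmas
    (h41 : LSSY2005_lemma41_periodic) (h52 : LSSY2005_lemma52_periodic) : LSSY2005_thm51_periodic := by
  intro v₁ hv₁ ha1 ρ g hρ hg
  obtain ⟨C₁, hC₁, H41⟩ := h41
  have ha : scatteringLength v₁ ≠ ⊤ := by rw [ha1]; exact ENNReal.one_ne_top
  -- the fixed-potential sequence `N ↦ n(N)/N`, `n(N) = periodicCondensateNumber v₁ N (N/g)`
  have key : Tendsto (fun N : ℕ => periodicCondensateNumber v₁ N (gpL g N) / N) atTop (𝓝 1) := by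
    refine tendsto_order.2 ⟨fun b hb => ?_, fun b hb => ?_⟩
    · -- lower bound: `b < 1`
      have hb' : b ≠ ⊤ := ne_top_of_lt hb
      have hbr : b.toReal < 1 := by
        have := (ENNReal.toReal_lt_toReal hb' ENNReal.one_ne_top).2 hb
        rwa [ENNReal.toReal_one] at this
      set ε : ℝ := (1 - b.toReal) / 2 with hεdef
      have hε : 0 < ε := by rw [hεdef]; linarith
      have hbε : b < ENNReal.ofReal (1 - ε) := by
        have h0 : 0 ≤ b.toReal := ENNReal.toReal_nonneg
        rw [← ENNReal.ofReal_toReal hb', ENNReal.ofReal_lt_ofReal_iff (by rw [hεdef]; linarith)]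
        rw [hεdef]; linarith
      filter_upwards [eventually_le_periodicCondensateNumber hC₁.le H41 h52 v₁ hv₁ ha1 hg hε,
        eventually_gt_atTop 0] with N hN hN0
      refine hbε.trans_le ?_
      rw [ENNReal.le_div_iff_mul_le (Or.inl (Nat.cast_ne_zero.2 hN0.ne'))
        (Or.inl (ENNReal.natCast_ne_top N))]
      exact hN
    · -- upper bound: `1 < b`
      filter_upwards [eventually_periodicCondensateNumber_le v₁ hv₁ ha hg,
        eventually_gt_atTop 0] with N hN hN0
      refine lt_of_le_of_lt ?_ hb
      rw [ENNReal.div_le_iff (Nat.cast_ne_zero.2 hN0.ne') (ENNReal.natCast_ne_top N), one_mul]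
      exact hN
  -- transfer to the GP sequence `(a_N⁻² v₁(·/a_N), L_N = (N/ρ)^{1/3})`
  refine key.congr' ?_
  filter_upwards [eventually_gt_atTop 0] with N hN
  rw [periodicCondensateNumber_gp_eq v₁ hρ hg hN]
  rfl

end Literature.Barriers.AtomisticToContinuum.BoseGas

namespace Literature.Barriers.AtomisticToContinuum

open Literature.MathematicalPhysics.QuantumManyBody.BoseGas BoseGas

/-- **The catalogue entry from the two lemmas**: `KineticGapLengthScales` (= LSSY Thm. 5.1,
periodic case) follows from the generalized Poincaré inequality (`LSSY2005_lemma41_periodic`) and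
the energy localization (`LSSY2005_lemma52_periodic`). [cite: LSSY2005, Thm. 5.1] -/
theorem kineticGapLengthScales_of_lemmas
    (h41 : LSSY2005_lemma41_periodic) (h52 : LSSY2005_lemma52_periodic) : KineticGapLengthScales :=
  LSSY2005_thm51_periodic_of_lemmas h41 h52

end Literature.Barriers.AtomisticToContinuum

end
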